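import Summits.QuantumFields.YangMills.Theorems.BalabanUVNodesN08AtRecord13CoPR
import Summits.QuantumFields.YangMills.Theorems.BalabanUVNodesN08AtRecord13Family
import Literature.MathematicalPhysics.QuantumFieldTheory.Balaban1983to89.Node00.Record13ResidualsR

/-!
# BalabanUVNodes ∕ N08 ON THE R-LIFTS OF THE STAGE-13 WITNESS FAMILIES — v1.6 `CoPR` EDITION OF RECORD 13 (director-ym LINE №169 (H1) ∕ №174 PRESS WORD; FINDING №8 = node00-def-T LOCATED-8 «the residual 𝐓-weight slot `Stage12Params.Zt K` is
RUN-BLIND while print's ζ ([Balaban1988Convergent] (1.11) p.248, (3.16)–(3.20) pp.268–269) reads the run»): def-T FILE 25 `Node00/Record13CoPR` (p529474 ✓ 3eadf656eaa8: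
`structure Stage13RParams extends Stage13Params` + the ONE new field `Zr : (p : B12.RunParams) → TkResidualW F N (FluctV N) p.K`, guard `Stage13RParams.ZrUnity`, 𝐓-weights
`WtOfRecord₁₃R θ p` reading `θ.Zr p`, the C-keyed provisos `Stage13RParams.Provisos₁₃CoPR` (the nine Core rows + `zrLaws ∕ zrLocal`), view `Stage13RParams.toStage5₁₃CoPR`, datum
`datumOfRecord₁₃CoPR`, record `IsRecordOfRecord₁₃CCoPR` + faces; run-blind embedding `Stage13RParams.ofRunBlind`) and FILE 26T `Node00/Record13SepCoPR` (p529780 ✓: `Provisos₁₃SepCoPR`,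
`datumOfRecord₁₃SepCoPR`, `IsRecordOfRecord₁₃CSepCoPR` + `.toCoPR`); dag-n10-d's R carrier leaves `Node00/Record13CarriersCoPR` (p530591 ✓: §0 THE R-PIN ALGEBRA `Stage13RParams.onBase ∕ rebindX ∕
pin<G>` (dag-lead DEDUP-286 (2), this seat's DESIGN-INPUT-R), `toStage5₁₃CoPR_rebindX ∕ _pin<G>`, `Provisos₁₃CoPR.rebindX ∕ .pin<G>`, `datumOfRecord₁₃CoPR_rebindX ∕ _pin<G>`,
`isRecordOfRecord₁₃CCoPR_rebindX_of_eq ∕ _pinB10_of_eq`, `exists_world_isRecordOfRecord₁₃CCoPR_rebindX`, the R views `Stage13RParams.view₁₃CoPRB10YZW ∕ …B8B10YZW` + `_eq` + `_leaves`) and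
`Node00/Record13CarriersSepCoPR` (n10-d file (2), in the tree 12:36Z: `Provisos₁₃SepCoPR.pin<G>`, `datumOfRecord₁₃SepCoPR_pin<G>`, `isRecordOfRecord₁₃CSepCoPR_pinB10_of_eq`).  Token map T₆ (plan IMPACT-169, def-T KEYMAP v1.6,
dag-lead WORDS-142): «the v1.5 names with `CoP ↦ CoPR`, binders `Stage13Params ↦ Stage13RParams`, `ZtUnity ↦ ZrUnity`, `Provisos₁₃Core ↦ Provisos₁₃CoPR` (C-keyed family), `θ.Zt p.K ↦ θ.Zr p`».
# THIS FILE = the T₆ image of `BalabanUVNodesN08AtRecord13CoPFamily` (p524963): N08's share of a C-keyed ₁₃ nodes-∃ WITNESSED AT THE R-LIFTS `⟨θ₀, Zr⟩` of node00-def-K0a's all-numerics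
# family `θ₀ = theta13LiveOfNumerics F N n ε₂₉ …` and two-letter family `θ₀ = theta13LiveOfFamily₂ …` (θ-level makers, background-free) by any run-indexed residual family `Zr`, where it
# costs the provisos there + `PrintedUV3V N F.L`; and THE SUPPLIER CURRENCIES OF THAT SLOT AT THE FAMILY'S OWN BLOCK SIZE `F.L` (Track A, DAG node N08 [Balaban1985UV3] CMP **102** (1985) 255, Thm 1 p. 257 (compact reading) + Thm 2 p. 272; R134 fan-out seat `pub-ymgap-dag-n08-c` g16, strategy s2
«knit at the record of record», trigger (t27) = №174 (3) «pens port their OWN files»; 2026-08-27)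

WHY THIS FILE.  p524963 is keyed on `Stage13Params ∕ Provisos₁₃Core ∕ datumOfRecord₁₃CoP ∕ IsRecordOfRecord₁₃CCoP`; at v1.6 the parameter type changes and K0a's ⁶ witnesses are
R-LIFTS of its v1.5 makers (K0a g9: «the cured witness = ⟨θ₁₅ᶜᶜ¹, ZrOfRecord₁₃ F 2 θ₁₅ᶜᶜ¹⟩», a member of the all-numerics family lifted), so the witness-line theorems are re-typed
here over this seat's R storey `BalabanUVNodesN08AtRecord13CoPR` (§2 `exists_world₁₃CCoPR_b10_main_of_slot`, §1 `b10_main_iff_of_up_pinB10`) AT THE GENERIC LIFT — name-free in K0a's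
eventual R-maker (any `def θR := ⟨θ₀, Zr₀⟩` is served by `exact`).  CITED, not re-declared: K0a's `admissible_ ∕ slotsNondegenerate₁₃_…_of_hasResiduals` faces of `θ₀` (through the base),
p494431's `rfl` faces (`theta13LiveOfNumerics_L ∕ _γ`, `theta13LiveOfFamily₂_L`), dag-n08-a ∕ n08-e's supplier faces.
HONEST DEPARTURES FROM A PURE TOKEN IMAGE (generator `tools/copr_n08_gen.py` + `tools/genericize_witness_n08.py`; every other statement SHAPE verbatim, proofs re-checked):
(i) the 𝐑-bundle `WOfRecord₁₃` (12a; reads no 𝐓-slot, NOT re-issued by def-T) is fed the base `θ.toStage13Params` (plan's K1 v4 text does the same); (ii) every WITNESS-LINE theorem is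
stated at the R-LIFT `⟨θ₀, Zr⟩ : Stage13RParams F N` of node00-def-K0a's v1.5 maker `θ₀` (`theta13LiveOfRecord ∕ theta13LiveOfNumerics … ∕ theta13LiveOfFamily₂ …`, θ-level and
background-free) by an ARBITRARY run-indexed residual family `Zr`; admissibility and `SlotsNondegenerate₁₃` of the lift ARE K0a's faces of `θ₀` through the base (definitional), while
the guard half `ZrUnity` — whose K0a hypothesis-free face `ztUnity_…` has no R image until K0a pins `Zr` (№174 (5)) — is DISPLAYED as `hZ` in the `N = 2` forms (K0a FILE 17
`ZrOfRecord₁₃ ∕ finsum_ζ0_ZrOfRecord₁₃`, dag-n11-d's diagonal cure as a definition, discharges it at `Zr := ZrOfRecord₁₃ F N θ₀`: `fun p j ω => finsum_ζ0_ZrOfRecord₁₃ …`).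

WHAT THIS FILE PROVES (kernel bookkeeping BY NAME; 0 `def`, 0 `sorry`).
* §1 AT `⟨θ₁₃(n, ε₂₉), Zr⟩`: `exists_world₁₃CCoPR_b10_main_at_theta13LiveOfNumerics (Zr) (hn : n.Pos) (hε' : 0 < ε₂₉) (hP : Provisos₁₃CoPR) (hUV : PrintedUV3V N F.L)` — a world of the
  lift's R datum (`w.γ = n.γ`, `w.L = F.L`) bound over the [B10]-pinned R view, a ₁₃CCoPR record carrying N08 at every run; `b10_main_iff_at_theta13LiveOfNumerics` (exact cost
  «in-edges → `PrintedUV3V N F.L`»); at `N = 2`: `exists_guarded_record₁₃CCoPR_b10_main_of_theta13Numerics_provisosCoPR_two (Zr) … (hZ) (hUV)`.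
* §2 AT `⟨θ₁₃(ε₀, ε₂₉), Zr⟩`: `exists_world₁₃CCoPR_b10_main_at_theta13LiveOfFamily₂ (Zr) (hε : 0 < ε₀) (hε')`, `exists_guarded_record₁₃CCoPR_b10_main_of_theta13Family₂_provisosCoPR_two`.
* §3 SUPPLIER CURRENCIES AT `L := F.L` into §1 (generic `N`): `…_at_theta13LiveOfNumerics_of_uniformLeafSystemsG ∕ _of_thm1Compact_perRun ∕ _of_perRunUniformO1` — (u) uniform leaf
  systems (dag-n08-a `printedUV3V_of_uniformLeafSystems_at`), (r) «relative to (5)» (dag-n08-e `printedUV3V_of_thm1Compact_perRun`), (o) per-run data with a run-uniform O(1)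
  (dag-n08-a `printedUV3V_of_perRunUniformO1`); §3b the same three INTO N08's conjunct at the lift, `N = 2`, provisos opaque, `hZ` displayed:
  `exists_guarded_record₁₃CCoPR_b10_main_of_theta13Numerics_provisosCoPR_two_of_uniformLeafSystemsG ∕ _of_thm1Compact_perRun ∕ _of_perRunUniformO1`.
HONEST FRAMING.  Count-neutral re-keying of a LANDED storey to the re-issued record (new file; p524963 stays as the ⁵ sibling); nothing of Bałaban's asserted: `n.Pos`, `0 < ε₂₉`
(`0 < ε₀`), `Provisos₁₃CoPR`, `hZ`, and `PrintedUV3V` or its supplier data are DISPLAYED hypotheses on every theorem; `Node00.PrintedUV3V` is TYPED, NOT PROVED — an inhabitant (the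
[B10] cluster expansion at print's run objects) remains THE object gap of N08; K0 ∕ K1 neither proved nor assumed; N08 NOT discharged; one finite four-torus per run at fixed `ε`,
[B10]'s d = 3 lattices inside the record; nothing continuum ∕ ℝ⁴ ∕ OS ∕ mass gap ∕ Clay.  0 `sorry`, 0 `def`, standard axioms.
Sources: [Balaban1985UV3] Thm 1 p.257, Thm 2 p.272, Sect. D pp.272–275; [Balaban1989LargeFieldII] Thm 1 + (0.1) pp.355–356; [Balaban1988Convergent] Thm 1 p.262, (1.11) p.248,
(2.18) p.257, (3.16)–(3.22) pp.268–269; [Balaban1987RG1] (0.1) p.251, (0.21) p.256, (2.9) p.266; [Balaban1989LargeFieldI] (0.3)–(0.4) p.176; [Balaban1985Averaging] (10) p.19.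
-/

noncomputable section

namespace Summit.QuantumFields.YangMills.BalabanUVNodes.N08AtRecord13CoPRFamily

open Literature.MathematicalPhysics.QuantumFieldTheory.Balaban1983to89
open Literature.MathematicalPhysics.QuantumFieldTheory.Balaban1983to89.T4Continuum (T4Family FiniteEpsData)
open Literature.MathematicalPhysics.QuantumFieldTheory.Balaban1983to89.DagBinding (WorldP leavesP)
open Literature.MathematicalPhysics.QuantumFieldTheory.Balaban1983to89.Node00
open Literature.MathematicalPhysics.QuantumFieldTheory.Balaban1983to89.B10RunsOfRecord (Consts UniformLeafSystemsG runObjects₀T Backgrounds runsAtG)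
open Literature.MathematicalPhysics.QuantumFieldTheory.Balaban1985CMP102
open Literature.MathematicalPhysics.QuantumFieldTheory.Balaban1985CMP102.Setting
open Literature.MathematicalPhysics.QuantumFieldTheory.Balaban1985CMP102.Theorems (Family)
open Summit.QuantumFields.YangMills.BalabanUVNodes.N08AtRecord13CoPR
open Summit.QuantumFields.YangMills.BalabanUVNodes.N08AtRecord9CB10 (printedUV3V_of_uniformLeafSystems_at)
open Summit.QuantumFields.YangMills.Theorems.BalabanUVNodesN08RelativeTo5 (printedUV3V_of_thm1Compact_perRun)
open Summit.QuantumFields.YangMills.Theorems.BalabanUVNodesN08UniformO1 (printedUV3V_of_perRunUniformO1)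
open scoped Matrix.Norms.L2Operator

/-! ## §1 ON THE ALL-NUMERICS STAGE-13 WITNESS FAMILY `θ₁₃(n, ε₂₉) = theta13LiveOfNumerics F N n ε₂₉ (zeta316OfRecord F N n.ν n.τ9.M n.A₁) (RzOfRecord F N) (ZtOfRecord F N)`
(K0b's residuals of record; block size `F.L`, window `n.γ`) — N08's share costs `PrintedUV3V N F.L` -/

section Numerics
variable (F : T4Family) (N : ℕ) [NeZero N] (Zr : (p : B12.RunParams) → TkResidualW F N (FluctV N) p.K) {n : Stage12Numerics} {ε₂₉ : ℝ}

/-- **N08's SHARE OF THE STAGE-13 NODES STUB AT ANY MEMBER `θ₁₃(n, ε₂₉)` COSTS THE SINGLE PROP `PrintedUV3V N F.L`** (plus the Core provisos `hP` at the member, HYPOTHESIS,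
and the two displayed signs `n.Pos`, `0 < ε₂₉` under which K0a's `admissible_theta13LiveOfNumerics` gives admissibility): a world of the member's datum of record (`w.γ = n.γ`,
`w.L = F.L`), bound over the [B10]-pinned CoPR view of the member, that IS a ₁₃CCoPR record and carries N08 at every run (the CoPR storey's §2 `exists_world₁₃CCoPR_b10_main_of_slot`).
At `N = 2`: [Balaban1985UV3] Thm 1-compact ∧ Thm 2 with their printed ∃-prefix for SU(2) at the family's block size `F.L`, at some version of print's transformations.
[cite: Balaban1985UV3, Thm 1 p.257, Thm 2 p.272; Balaban1989LargeFieldII, Thm 1 + (0.1) pp.355–356; Balaban1987RG1, (0.21) p.256, (2.9) p.266 (bookkeeping)] -/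
theorem exists_world₁₃CCoPR_b10_main_at_theta13LiveOfNumerics (hn : n.Pos) (hε' : 0 < ε₂₉)
    (hP : (⟨theta13LiveOfNumerics F N n ε₂₉ (zeta316OfRecord F N n.ν n.τ9.M n.A₁) (RzOfRecord F N) (ZtOfRecord F N), Zr⟩ : Stage13RParams F N).Provisos₁₃CoPR F N)
    (hUV : PrintedUV3V N F.L) :
    ∃ w : WorldP,
      IsRecordOfRecord₁₃CCoPR F N
          (datumOfRecord₁₃CoPR F N (⟨theta13LiveOfNumerics F N n ε₂₉ (zeta316OfRecord F N n.ν n.τ9.M n.A₁) (RzOfRecord F N) (ZtOfRecord F N), Zr⟩ : Stage13RParams F N) hP) w ∧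
        w.γ = n.γ ∧ w.L = (F.L : ℝ) ∧
        (∀ P, w.up P = upOfRecord₅C F N
          (((⟨theta13LiveOfNumerics F N n ε₂₉ (zeta316OfRecord F N n.ν n.τ9.M n.A₁) (RzOfRecord F N) (ZtOfRecord F N), Zr⟩ : Stage13RParams F N).pinB10 F N).toStage5₁₃CoPR F N) P) ∧
        ∀ P : B12.RunParams, Dag.B10_main (leavesP w P) :=
  have hθ := admissible_theta13LiveOfNumerics F N (zeta316OfRecord F N n.ν n.τ9.M n.A₁) (RzOfRecord F N) (ZtOfRecord F N) hn hε'
  exists_world₁₃CCoPR_b10_main_of_slot _ hP hθ (γw := n.γ) ⟨hθ.toStage9.gamma_pos, le_rfl⟩ hUV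

/-- **EXACT COST AT THE MEMBER**: at any world bound over the [B10]-pinned view of `θ₁₃(n, ε₂₉)`, N08 at a run ⟺ «in-edge leaves ⟹ `PrintedUV3V N F.L`». [cite: Balaban1985UV3, Thm 1 p.257, Thm 2 p.272] -/
theorem b10_main_iff_at_theta13LiveOfNumerics {w : WorldP}
    (hup : ∀ P, w.up P = upOfRecord₅C F N
      (((⟨theta13LiveOfNumerics F N n ε₂₉ (zeta316OfRecord F N n.ν n.τ9.M n.A₁) (RzOfRecord F N) (ZtOfRecord F N), Zr⟩ : Stage13RParams F N).pinB10 F N).toStage5₁₃CoPR F N) P)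
    (P : B12.RunParams) :
    Dag.B10_main (leavesP w P) ↔
      ((leavesP w P).b5 → (leavesP w P).b6 → (leavesP w P).b7 → (leavesP w P).b8 → (leavesP w P).b9 → (leavesP w P).b11 → PrintedUV3V N F.L) :=
  b10_main_iff_of_up_pinB10 _ hup P

/-- **N08's CONJUNCT OF THE STAGE-13 NODES-∃, WITNESSED AT THE MEMBER `θL F n ε₂₉`, `N = 2`** — from the Core provisos at the member (`hP : Provisos₁₃CoPR`, HYPOTHESIS), the signs
`n.Pos`, `0 < ε₂₉`, and `PrintedUV3V 2 F.L`: the guard (the DISPLAYED `hZ : ZrUnity` of the lift ∕ K0a's HYPOTHESIS-FREE `slotsNondegenerate₁₃_theta13LiveOfNumerics_of_hasResiduals`) and admissibility are K0a's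
theorems BY NAME.  NOT the stub, NOT a discharge. [cite: Balaban1985UV3, Thm 1 p.257, Thm 2 p.272; Balaban1988Convergent, Thm 1 p.262, (3.16)–(3.22) pp.268–269; Balaban1989LargeFieldI, (0.3)–(0.4) p.176 (bookkeeping)] -/
theorem exists_guarded_record₁₃CCoPR_b10_main_of_theta13Numerics_provisosCoPR_two (F : T4Family) (Zr : (p : B12.RunParams) → TkResidualW F 2 (FluctV 2) p.K) {n : Stage12Numerics} {ε₂₉ : ℝ} (hn : n.Pos) (hε' : 0 < ε₂₉)
    (hP : (⟨theta13LiveOfNumerics F 2 n ε₂₉ (zeta316OfRecord F 2 n.ν n.τ9.M n.A₁) (RzOfRecord F 2) (ZtOfRecord F 2), Zr⟩ : Stage13RParams F 2).Provisos₁₃CoPR F 2)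
    (hZ : (⟨theta13LiveOfNumerics F 2 n ε₂₉ (zeta316OfRecord F 2 n.ν n.τ9.M n.A₁) (RzOfRecord F 2) (ZtOfRecord F 2), Zr⟩ : Stage13RParams F 2).ZrUnity F 2) (hUV : PrintedUV3V 2 F.L) :
    ∃ (θ : Stage13RParams F 2) (h : θ.Provisos₁₃CoPR F 2) (w : WorldP), (θ.ZrUnity F 2 ∧ θ.SlotsNondegenerate₁₃ F 2) ∧ θ.Admissible F 2 ∧
      IsRecordOfRecord₁₃CCoPR F 2 (datumOfRecord₁₃CoPR F 2 θ h) w ∧ ∀ P : B12.RunParams, Dag.B10_main (leavesP w P) := by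
  obtain ⟨w, hR, -, -, -, hN⟩ := exists_world₁₃CCoPR_b10_main_at_theta13LiveOfNumerics F 2 Zr hn hε' hP hUV
  exact ⟨_, hP, w, ⟨hZ, slotsNondegenerate₁₃_theta13LiveOfNumerics_of_hasResiduals F 2 n ε₂₉⟩,
    admissible_theta13LiveOfNumerics F 2 _ _ _ hn hε', hR, hN⟩

/-- **THE SAME AT node00-def-K0a's PIN OF RECORD `Zr := ZrOfRecord₁₃ F 2 θL`** (FILE 17 `Node00/Record13ResidualsR`: dag-n11-d's diagonal cure made a definition; K0a g9: «the cured
witness = `⟨θ₁₅…, ZrOfRecord₁₃ F 2 θ₁₅…⟩`», a lift of a member of this family): the guard's `ZrUnity` half IS K0a's `finsum_ζ0_ZrOfRecord₁₃` (every generation, every run), so at the cured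
lift N08's conjunct costs EXACTLY what it cost at ⁵ — the provisos there (HYPOTHESIS, opaque), the signs, and `PrintedUV3V 2 F.L`.  NOT the stub, NOT a discharge.
[cite: Balaban1985UV3, Thm 1 p.257, Thm 2 p.272; Balaban1988Convergent, (1.11) p.248, (3.16)–(3.22) pp.268–269; Balaban1989LargeFieldI, (0.3)–(0.4) p.176 (bookkeeping)] -/
theorem exists_guarded_record₁₃CCoPR_b10_main_of_theta13Numerics_provisosCoPR_two_at_ZrOfRecord₁₃ (F : T4Family) {n : Stage12Numerics} {ε₂₉ : ℝ} (hn : n.Pos)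
    (hε' : 0 < ε₂₉)
    (hP : (⟨theta13LiveOfNumerics F 2 n ε₂₉ (zeta316OfRecord F 2 n.ν n.τ9.M n.A₁) (RzOfRecord F 2) (ZtOfRecord F 2),
      ZrOfRecord₁₃ F 2 (theta13LiveOfNumerics F 2 n ε₂₉ (zeta316OfRecord F 2 n.ν n.τ9.M n.A₁) (RzOfRecord F 2) (ZtOfRecord F 2))⟩ : Stage13RParams F 2).Provisos₁₃CoPR F 2)
    (hUV : PrintedUV3V 2 F.L) :
    ∃ (θ : Stage13RParams F 2) (h : θ.Provisos₁₃CoPR F 2) (w : WorldP), (θ.ZrUnity F 2 ∧ θ.SlotsNondegenerate₁₃ F 2) ∧ θ.Admissible F 2 ∧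
      IsRecordOfRecord₁₃CCoPR F 2 (datumOfRecord₁₃CoPR F 2 θ h) w ∧ ∀ P : B12.RunParams, Dag.B10_main (leavesP w P) :=
  exists_guarded_record₁₃CCoPR_b10_main_of_theta13Numerics_provisosCoPR_two F _ hn hε' hP (fun _ j ω => finsum_ζ0_ZrOfRecord₁₃ j ω) hUV

end Numerics

/-! ## §2 ON THE TWO-LETTER STAGE-13 WITNESS FAMILY `θ₁₃(ε₀, ε₂₉) = theta13LiveOfFamily₂ F N ε₀ ε₂₉ (zeta316OfRecord F N (numerics7OfFamily ε₀) 1 1) (RzOfRecord F N) (ZtOfRecord F N)`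
(block size `F.L`, window `1∕2`) — the member `n := stage12NumericsOfFamily ε₀` of §1; the witness of record is `(ε₀, ε₂₉) = (1, ⅛)` -/

section Family₂
variable (F : T4Family) (N : ℕ) [NeZero N] (Zr : (p : B12.RunParams) → TkResidualW F N (FluctV N) p.K) {ε₀ ε₂₉ : ℝ}

/-- **N08's SHARE AT ANY MEMBER `θ₁₃(ε₀, ε₂₉)` COSTS `PrintedUV3V N F.L`** (plus `hP : Provisos₁₃CoPR` there and the signs `0 < ε₀`, `0 < ε₂₉`; admissibility is K0a's
`admissible_theta13LiveOfFamily₂`): a world of the member's CoPR datum (`w.γ = 1∕2`, `w.L = F.L`) bound over the [B10]-pinned CoPR view, a ₁₃CCoPR record carrying N08 at every run.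
[cite: Balaban1985UV3, Thm 1 p.257, Thm 2 p.272; Balaban1989LargeFieldII, Thm 1 + (0.1) pp.355–356; Balaban1987RG1, (1.2) p.260, (2.9) p.266 (bookkeeping)] -/
theorem exists_world₁₃CCoPR_b10_main_at_theta13LiveOfFamily₂ (hε : 0 < ε₀) (hε' : 0 < ε₂₉)
    (hP : (⟨theta13LiveOfFamily₂ F N ε₀ ε₂₉ (zeta316OfRecord F N (numerics7OfFamily ε₀) 1 1) (RzOfRecord F N) (ZtOfRecord F N), Zr⟩ : Stage13RParams F N).Provisos₁₃CoPR F N)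
    (hUV : PrintedUV3V N F.L) :
    ∃ w : WorldP,
      IsRecordOfRecord₁₃CCoPR F N
          (datumOfRecord₁₃CoPR F N (⟨theta13LiveOfFamily₂ F N ε₀ ε₂₉ (zeta316OfRecord F N (numerics7OfFamily ε₀) 1 1) (RzOfRecord F N) (ZtOfRecord F N), Zr⟩ : Stage13RParams F N) hP) w ∧
        w.γ = 1 / 2 ∧ w.L = (F.L : ℝ) ∧
        (∀ P, w.up P = upOfRecord₅C F N
          (((⟨theta13LiveOfFamily₂ F N ε₀ ε₂₉ (zeta316OfRecord F N (numerics7OfFamily ε₀) 1 1) (RzOfRecord F N) (ZtOfRecord F N), Zr⟩ : Stage13RParams F N).pinB10 F N).toStage5₁₃CoPR F N) P) ∧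
        ∀ P : B12.RunParams, Dag.B10_main (leavesP w P) :=
  exists_world₁₃CCoPR_b10_main_of_slot _ hP (admissible_theta13LiveOfFamily₂ F N _ _ _ hε hε') (γw := 1 / 2)
    ⟨one_half_pos, (theta13LiveOfFamily₂_γ F N ε₀ ε₂₉ _ _ _).symm.le⟩ hUV

/-- **N08's CONJUNCT OF THE STAGE-13 NODES-∃, WITNESSED AT THE MEMBER `θ₁₃(ε₀, ε₂₉)`, `N = 2`** — from `hP : Provisos₁₃CoPR` there (HYPOTHESIS), `0 < ε₀`, `0 < ε₂₉` and
`PrintedUV3V 2 F.L`; guard (HYPOTHESIS-FREE) and admissibility are K0a's theorems BY NAME.  NOT the stub, NOT a discharge. [cite: Balaban1985UV3, Thm 1 p.257, Thm 2 p.272; Balaban1988Convergent, Thm 1 p.262, (3.16)–(3.22) pp.268–269; Balaban1989LargeFieldI, (0.3)–(0.4) p.176 (bookkeeping)] -/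
theorem exists_guarded_record₁₃CCoPR_b10_main_of_theta13Family₂_provisosCoPR_two (F : T4Family) (Zr : (p : B12.RunParams) → TkResidualW F 2 (FluctV 2) p.K) {ε₀ ε₂₉ : ℝ} (hε : 0 < ε₀) (hε' : 0 < ε₂₉)
    (hP : (⟨theta13LiveOfFamily₂ F 2 ε₀ ε₂₉ (zeta316OfRecord F 2 (numerics7OfFamily ε₀) 1 1) (RzOfRecord F 2) (ZtOfRecord F 2), Zr⟩ : Stage13RParams F 2).Provisos₁₃CoPR F 2)
    (hZ : (⟨theta13LiveOfFamily₂ F 2 ε₀ ε₂₉ (zeta316OfRecord F 2 (numerics7OfFamily ε₀) 1 1) (RzOfRecord F 2) (ZtOfRecord F 2), Zr⟩ : Stage13RParams F 2).ZrUnity F 2) (hUV : PrintedUV3V 2 F.L) :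
    ∃ (θ : Stage13RParams F 2) (h : θ.Provisos₁₃CoPR F 2) (w : WorldP), (θ.ZrUnity F 2 ∧ θ.SlotsNondegenerate₁₃ F 2) ∧ θ.Admissible F 2 ∧
      IsRecordOfRecord₁₃CCoPR F 2 (datumOfRecord₁₃CoPR F 2 θ h) w ∧ ∀ P : B12.RunParams, Dag.B10_main (leavesP w P) := by
  obtain ⟨w, hR, -, -, -, hN⟩ := exists_world₁₃CCoPR_b10_main_at_theta13LiveOfFamily₂ F 2 Zr hε hε' hP hUV
  exact ⟨_, hP, w, ⟨hZ, slotsNondegenerate₁₃_theta13LiveOfFamily₂_of_hasResiduals F 2 ε₀ ε₂₉⟩,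
    admissible_theta13LiveOfFamily₂ F 2 _ _ _ hε hε', hR, hN⟩

end Family₂

/-! ## §3 THE SUPPLIER CURRENCIES OF THE SLOT AT THE FAMILY'S OWN BLOCK SIZE `F.L` — (u) uniform leaf systems, (r) «relative to (5)», (o) per-run data with a run-uniform
O(1) — on print's `F.L`-runs `runObjects₀T N 𝔗 (Backgrounds.ofPrint N F.L)` at a version `𝔗 : TFamily₃ N F.L` of print's transformations (2) -/

section SupplierNumerics
variable (F : T4Family) (N : ℕ) [NeZero N] (Zr : (p : B12.RunParams) → TkResidualW F N (FluctV N) p.K) {n : Stage12Numerics} {ε₂₉ : ℝ}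

/-- **CURRENCY (u) AT THE MEMBER `θ₁₃(n, ε₂₉)` — UNIFORM LEAF SYSTEMS AT BLOCK SIZE `F.L`**: a version `𝔗` of print's transformations on the `F.L`-runs, admissible constants `c`
and uniform leaf systems on print's run objects give N08's world at the member's datum (dag-n08-a's supplier face `printedUV3V_of_uniformLeafSystems_at` BY NAME into §1).
[cite: Balaban1985UV3, Thm 1 p.257, Thm 2 p.272, Sect. D pp.272–275; Balaban1985Averaging, (10) p.19] -/
theorem exists_world₁₃CCoPR_b10_main_at_theta13LiveOfNumerics_of_uniformLeafSystemsG (hn : n.Pos) (hε' : 0 < ε₂₉)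
    (hP : (⟨theta13LiveOfNumerics F N n ε₂₉ (zeta316OfRecord F N n.ν n.τ9.M n.A₁) (RzOfRecord F N) (ZtOfRecord F N), Zr⟩ : Stage13RParams F N).Provisos₁₃CoPR F N)
    (𝔗 : TFamily₃ N F.L) (c : Consts F.L) (hc : c.Adm) (hU : UniformLeafSystemsG N (runObjects₀T N 𝔗 (Backgrounds.ofPrint N F.L)) c) :
    ∃ w : WorldP,
      IsRecordOfRecord₁₃CCoPR F N
          (datumOfRecord₁₃CoPR F N (⟨theta13LiveOfNumerics F N n ε₂₉ (zeta316OfRecord F N n.ν n.τ9.M n.A₁) (RzOfRecord F N) (ZtOfRecord F N), Zr⟩ : Stage13RParams F N) hP) w ∧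
        w.γ = n.γ ∧ w.L = (F.L : ℝ) ∧
        (∀ P, w.up P = upOfRecord₅C F N
          (((⟨theta13LiveOfNumerics F N n ε₂₉ (zeta316OfRecord F N n.ν n.τ9.M n.A₁) (RzOfRecord F N) (ZtOfRecord F N), Zr⟩ : Stage13RParams F N).pinB10 F N).toStage5₁₃CoPR F N) P) ∧
        ∀ P : B12.RunParams, Dag.B10_main (leavesP w P) :=
  exists_world₁₃CCoPR_b10_main_at_theta13LiveOfNumerics F N Zr hn hε' hP (printedUV3V_of_uniformLeafSystems_at 𝔗 ⟨c, hc, hU⟩)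

/-- **CURRENCY (r) AT THE MEMBER — «RELATIVE TO (5)»**: a version `𝔗`, admissible constants `c`, Thm 1's bounds (5) in the compact reading on the `F.L`-runs (LOCATED HYPOTHESIS
`h5`, print's «O(1) independent of ε, k», p. 257 L1) and per-run representation data `hdata` give N08's world at the member's datum (dag-n08-e's supplier face
`printedUV3V_of_thm1Compact_perRun` BY NAME). [cite: Balaban1985UV3, Thm 1 p.257 (compact reading), Thm 2 p.272, Sect. D pp.272–275] -/
theorem exists_world₁₃CCoPR_b10_main_at_theta13LiveOfNumerics_of_thm1Compact_perRun (hn : n.Pos) (hε' : 0 < ε₂₉)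
    (hP : (⟨theta13LiveOfNumerics F N n ε₂₉ (zeta316OfRecord F N n.ν n.τ9.M n.A₁) (RzOfRecord F N) (ZtOfRecord F N), Zr⟩ : Stage13RParams F N).Provisos₁₃CoPR F N)
    (𝔗 : TFamily₃ N F.L) (c : Consts F.L) (hc : c.Adm)
    (h5 : B10.Thm1PrintedCompact (runsAtG N (runObjects₀T N 𝔗 (Backgrounds.ofPrint N F.L)) c))
    (hdata : ∀ S : Family F.L c.eps0, ∃ (C : B10Assembly.Consts) (W : SectB.TowerObjects S.1 (SU N)),
      W.toRunObjects = runObjects₀T N 𝔗 (Backgrounds.ofPrint N F.L) c S.1 ∧ Nonempty (B10Assembly.LeafSystem C W.pin.toTowerRun)) :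
    ∃ w : WorldP,
      IsRecordOfRecord₁₃CCoPR F N
          (datumOfRecord₁₃CoPR F N (⟨theta13LiveOfNumerics F N n ε₂₉ (zeta316OfRecord F N n.ν n.τ9.M n.A₁) (RzOfRecord F N) (ZtOfRecord F N), Zr⟩ : Stage13RParams F N) hP) w ∧
        w.γ = n.γ ∧ w.L = (F.L : ℝ) ∧
        (∀ P, w.up P = upOfRecord₅C F N
          (((⟨theta13LiveOfNumerics F N n ε₂₉ (zeta316OfRecord F N n.ν n.τ9.M n.A₁) (RzOfRecord F N) (ZtOfRecord F N), Zr⟩ : Stage13RParams F N).pinB10 F N).toStage5₁₃CoPR F N) P) ∧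
        ∀ P : B12.RunParams, Dag.B10_main (leavesP w P) :=
  exists_world₁₃CCoPR_b10_main_at_theta13LiveOfNumerics F N Zr hn hε' hP (printedUV3V_of_thm1Compact_perRun N F.L 𝔗 c hc h5 hdata)

/-- **CURRENCY (o) AT THE MEMBER — PER-RUN DATA WITH A RUN-UNIFORM O(1)**: a version `𝔗`, admissible constants `c`, and per-run representation data on the `F.L`-runs whose
displayed O(1) is bounded by one `O` across the family give N08's world at the member's datum (dag-n08-a's sharpest data currency `printedUV3V_of_perRunUniformO1` BY NAME).
[cite: Balaban1985UV3, Thm 1 p.257 L1, Thm 2 p.272, Sect. D pp.272–274] -/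
theorem exists_world₁₃CCoPR_b10_main_at_theta13LiveOfNumerics_of_perRunUniformO1 (hn : n.Pos) (hε' : 0 < ε₂₉)
    (hP : (⟨theta13LiveOfNumerics F N n ε₂₉ (zeta316OfRecord F N n.ν n.τ9.M n.A₁) (RzOfRecord F N) (ZtOfRecord F N), Zr⟩ : Stage13RParams F N).Provisos₁₃CoPR F N)
    (𝔗 : TFamily₃ N F.L) (c : Consts F.L) (hc : c.Adm) (O : ℝ → ℝ → ℝ)
    (h : ∀ S : Family F.L c.eps0, ∃ (C : B10Assembly.Consts) (W : SectB.TowerObjects S.1 (SU N)),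
      W.toRunObjects = runObjects₀T N 𝔗 (Backgrounds.ofPrint N F.L) c S.1 ∧ Nonempty (B10Assembly.LeafSystem C W.pin.toTowerRun) ∧
        ∀ gmin gmax : ℝ, 0 < gmin → gmin ≤ gmax → B10Assembly.O1 C gmin gmax ≤ O gmin gmax) :
    ∃ w : WorldP,
      IsRecordOfRecord₁₃CCoPR F N
          (datumOfRecord₁₃CoPR F N (⟨theta13LiveOfNumerics F N n ε₂₉ (zeta316OfRecord F N n.ν n.τ9.M n.A₁) (RzOfRecord F N) (ZtOfRecord F N), Zr⟩ : Stage13RParams F N) hP) w ∧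
        w.γ = n.γ ∧ w.L = (F.L : ℝ) ∧
        (∀ P, w.up P = upOfRecord₅C F N
          (((⟨theta13LiveOfNumerics F N n ε₂₉ (zeta316OfRecord F N n.ν n.τ9.M n.A₁) (RzOfRecord F N) (ZtOfRecord F N), Zr⟩ : Stage13RParams F N).pinB10 F N).toStage5₁₃CoPR F N) P) ∧
        ∀ P : B12.RunParams, Dag.B10_main (leavesP w P) :=
  exists_world₁₃CCoPR_b10_main_at_theta13LiveOfNumerics F N Zr hn hε' hP (printedUV3V_of_perRunUniformO1 N F.L 𝔗 c hc O h)

end SupplierNumerics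

section SupplierGuarded
variable (F : T4Family) (Zr : (p : B12.RunParams) → TkResidualW F 2 (FluctV 2) p.K) {n : Stage12Numerics} {ε₂₉ : ℝ}

/-- **CURRENCY (u) INTO N08's CONJUNCT OF A CORE-KEYED ₁₃ NODES-∃ AT THE MEMBER `θL F n ε₂₉`, `N = 2`**: the signs, the Core provisos at the member (`hP`, HYPOTHESIS, opaque),
and — in place of `PrintedUV3V 2 F.L` — a version `𝔗 : TFamily₃ 2 F.L` of print's transformations with admissible constants and UNIFORM LEAF SYSTEMS on print's `F.L`-run
objects for SU(2) (dag-n08-a's supplier face BY NAME into §1).  What a d = 3 lane END theorem must deliver for N08 AT THE RECORD, in the uniform currency. [cite: Balaban1985UV3, Thm 1 p.257, Thm 2 p.272, Sect. D pp.272–275; Balaban1988Convergent, (3.16)–(3.22) pp.268–269 (bookkeeping)] -/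
theorem exists_guarded_record₁₃CCoPR_b10_main_of_theta13Numerics_provisosCoPR_two_of_uniformLeafSystemsG (hn : n.Pos) (hε' : 0 < ε₂₉)
    (hP : (⟨theta13LiveOfNumerics F 2 n ε₂₉ (zeta316OfRecord F 2 n.ν n.τ9.M n.A₁) (RzOfRecord F 2) (ZtOfRecord F 2), Zr⟩ : Stage13RParams F 2).Provisos₁₃CoPR F 2)
    (hZ : (⟨theta13LiveOfNumerics F 2 n ε₂₉ (zeta316OfRecord F 2 n.ν n.τ9.M n.A₁) (RzOfRecord F 2) (ZtOfRecord F 2), Zr⟩ : Stage13RParams F 2).ZrUnity F 2) (𝔗 : TFamily₃ 2 F.L) (c : Consts F.L) (hc : c.Adm) (hU : UniformLeafSystemsG 2 (runObjects₀T 2 𝔗 (Backgrounds.ofPrint 2 F.L)) c) :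
    ∃ (θ : Stage13RParams F 2) (h : θ.Provisos₁₃CoPR F 2) (w : WorldP), (θ.ZrUnity F 2 ∧ θ.SlotsNondegenerate₁₃ F 2) ∧ θ.Admissible F 2 ∧
      IsRecordOfRecord₁₃CCoPR F 2 (datumOfRecord₁₃CoPR F 2 θ h) w ∧ ∀ P : B12.RunParams, Dag.B10_main (leavesP w P) :=
  exists_guarded_record₁₃CCoPR_b10_main_of_theta13Numerics_provisosCoPR_two F Zr hn hε' hP hZ (printedUV3V_of_uniformLeafSystems_at 𝔗 ⟨c, hc, hU⟩)

/-- **CURRENCY (r) INTO N08's CONJUNCT AT THE MEMBER, `N = 2`** — the signs, the Core provisos at the member, a version `𝔗`, admissible `c`, Thm 1's bounds (5) in the compact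
reading on the `F.L`-runs for SU(2) (LOCATED HYPOTHESIS `h5`) and per-run representation data `hdata` (dag-n08-e's currency BY NAME: what the END theorem must add to its per-run
towers is exactly `h5`). [cite: Balaban1985UV3, Thm 1 p.257 (compact reading), Thm 2 p.272, Sect. D pp.272–275; Balaban1988Convergent, (3.16)–(3.22) pp.268–269 (bookkeeping)] -/
theorem exists_guarded_record₁₃CCoPR_b10_main_of_theta13Numerics_provisosCoPR_two_of_thm1Compact_perRun (hn : n.Pos) (hε' : 0 < ε₂₉)
    (hP : (⟨theta13LiveOfNumerics F 2 n ε₂₉ (zeta316OfRecord F 2 n.ν n.τ9.M n.A₁) (RzOfRecord F 2) (ZtOfRecord F 2), Zr⟩ : Stage13RParams F 2).Provisos₁₃CoPR F 2)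
    (hZ : (⟨theta13LiveOfNumerics F 2 n ε₂₉ (zeta316OfRecord F 2 n.ν n.τ9.M n.A₁) (RzOfRecord F 2) (ZtOfRecord F 2), Zr⟩ : Stage13RParams F 2).ZrUnity F 2) (𝔗 : TFamily₃ 2 F.L) (c : Consts F.L) (hc : c.Adm)
    (h5 : B10.Thm1PrintedCompact (runsAtG 2 (runObjects₀T 2 𝔗 (Backgrounds.ofPrint 2 F.L)) c))
    (hdata : ∀ S : Family F.L c.eps0, ∃ (C : B10Assembly.Consts) (W : SectB.TowerObjects S.1 (SU 2)),
      W.toRunObjects = runObjects₀T 2 𝔗 (Backgrounds.ofPrint 2 F.L) c S.1 ∧ Nonempty (B10Assembly.LeafSystem C W.pin.toTowerRun)) :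
    ∃ (θ : Stage13RParams F 2) (h : θ.Provisos₁₃CoPR F 2) (w : WorldP), (θ.ZrUnity F 2 ∧ θ.SlotsNondegenerate₁₃ F 2) ∧ θ.Admissible F 2 ∧
      IsRecordOfRecord₁₃CCoPR F 2 (datumOfRecord₁₃CoPR F 2 θ h) w ∧ ∀ P : B12.RunParams, Dag.B10_main (leavesP w P) :=
  exists_guarded_record₁₃CCoPR_b10_main_of_theta13Numerics_provisosCoPR_two F Zr hn hε' hP hZ (printedUV3V_of_thm1Compact_perRun 2 F.L 𝔗 c hc h5 hdata)

/-- **CURRENCY (o) INTO N08's CONJUNCT AT THE MEMBER, `N = 2`** — the signs, the Core provisos at the member, a version `𝔗`, admissible `c`, and per-run representation data on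
the `F.L`-runs whose displayed O(1) is bounded by one `O` across the family (dag-n08-a's sharpest data currency BY NAME). [cite: Balaban1985UV3, Thm 1 p.257 L1, Thm 2 p.272, Sect. D pp.272–274; Balaban1988Convergent, (3.16)–(3.22) pp.268–269 (bookkeeping)] -/
theorem exists_guarded_record₁₃CCoPR_b10_main_of_theta13Numerics_provisosCoPR_two_of_perRunUniformO1 (hn : n.Pos) (hε' : 0 < ε₂₉)
    (hP : (⟨theta13LiveOfNumerics F 2 n ε₂₉ (zeta316OfRecord F 2 n.ν n.τ9.M n.A₁) (RzOfRecord F 2) (ZtOfRecord F 2), Zr⟩ : Stage13RParams F 2).Provisos₁₃CoPR F 2)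
    (hZ : (⟨theta13LiveOfNumerics F 2 n ε₂₉ (zeta316OfRecord F 2 n.ν n.τ9.M n.A₁) (RzOfRecord F 2) (ZtOfRecord F 2), Zr⟩ : Stage13RParams F 2).ZrUnity F 2) (𝔗 : TFamily₃ 2 F.L) (c : Consts F.L) (hc : c.Adm) (O : ℝ → ℝ → ℝ)
    (h : ∀ S : Family F.L c.eps0, ∃ (C : B10Assembly.Consts) (W : SectB.TowerObjects S.1 (SU 2)),
      W.toRunObjects = runObjects₀T 2 𝔗 (Backgrounds.ofPrint 2 F.L) c S.1 ∧ Nonempty (B10Assembly.LeafSystem C W.pin.toTowerRun) ∧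
        ∀ gmin gmax : ℝ, 0 < gmin → gmin ≤ gmax → B10Assembly.O1 C gmin gmax ≤ O gmin gmax) :
    ∃ (θ : Stage13RParams F 2) (h : θ.Provisos₁₃CoPR F 2) (w : WorldP), (θ.ZrUnity F 2 ∧ θ.SlotsNondegenerate₁₃ F 2) ∧ θ.Admissible F 2 ∧
      IsRecordOfRecord₁₃CCoPR F 2 (datumOfRecord₁₃CoPR F 2 θ h) w ∧ ∀ P : B12.RunParams, Dag.B10_main (leavesP w P) :=
  exists_guarded_record₁₃CCoPR_b10_main_of_theta13Numerics_provisosCoPR_two F Zr hn hε' hP hZ (printedUV3V_of_perRunUniformO1 2 F.L 𝔗 c hc O h)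

end SupplierGuarded

end Summit.QuantumFields.YangMills.BalabanUVNodes.N08AtRecord13CoPRFamily

end
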